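import Literature.MathematicalPhysics.KineticTheory.HardSphereUniformGas
import Summits.AtomisticToContinuum.HydrodynamicLimit.Theorems.KineticWindowGronwall.Negative.ActivityDummy
import HarnessLib

/-!
# The homogeneous local Gibbs law under a velocity translation (helper, Galilean boost: statics)

Crux `Summit.AtomisticToContinuum.HydrodynamicLimit.Theses.AntiMazurCoboundaries.KineticWindowGronwall`
(stmt-AtomisticToContinuum-9282), line `dlr-block-transfer` v6, registered helper stub `stub_boostGibbs :
LocalGibbsLawBoost` toward the lead's stub `stub_frameCovariance` (the constants of the kinetic hypothesis are
universal in the frame `(a, θ, u₀)`). The sibling files `…KineticWindowGronwallBoostTrajectory` / `…BoostFlow`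
transport TRAJECTORIES and FLOWS under the time-dependent Galilean boost `boostAt u t z = (x_i + t u, v_i + u)_i`;
this self-contained, statics-only file transports the INITIAL LAW under its time-`0` map, the velocity translation
`velShift u z = (x_i, v_i + u)_i` (`= boostAt u 0`, by `rfl`/`funext` on the lead's side): the homogeneous
(constant-profile) local Gibbs law `G_N(a, u₀, θ) = localGibbsLaw σ (fun _ => a) (fun _ => u₀) (fun _ => θ) N Φ` of
`HardSphereEuler` (which depends on the flow `Φ` only through its type). It mirrors the thermal-scaling template
`…KineticWindowGronwallThermalScalingGibbs` (`v ↦ c v`) with `v ↦ v + u`.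

THE IDENTITY. `(velShift u)_# G_N(a, u₀, θ) = G_N(a, u₀ + u, θ)` for every activity `a`, `θ > 0`, `u₀, u ∈ ℝ³`
(`localGibbsLaw_const_map_velShift`; registered form `stub_boostGibbs : LocalGibbsLawBoost`, stated with the map
written out and an arbitrary type-fixing target flow `Ψ` — e.g. the boosted flow of layer 2). PROOF: by the rung-0
product structure `localGibbsMeasure_rung0_eq_map` (`HardSphereUniformGas`) the law is
`zipConfig_# (posGibbs ⊗ ⊗ᵢ N(u₀, θ))` for `a ≥ 0`; `velShift u ∘ zipConfig = zipConfig ∘ (id × (v ↦ (vᵢ + u)ᵢ))`,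
the position factor (hard core, activity) is untouched and the isotropic Gaussian
`N(u₀, θ) = (w ↦ u₀ + √θ w)_# N(0, 1)` is mapped by `v ↦ v + u` to `N(u₀ + u, θ)` (`gaussMeasure_map_add_const`,
`u₀ + √θ w + u = (u₀ + u) + √θ w`); a non-zero activity cancels from the canonical density
(`localGibbsLaw_const_activity` of `Theorems/KineticWindowGronwall/Negative/ActivityDummy`), which covers `a < 0`.
Consequences: `∫⁻ F dG_N(a, u₀ + u, θ) = ∫⁻ F ∘ velShift u dG_N(a, u₀, θ)` (`lintegral_localGibbsLaw_velShift`, no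
measurability: `velShift u` is a measurable automorphism `velShiftEquiv u` with inverse `velShift (-u)`), masses of
measurable sets (`localGibbsLaw_velShift_apply`), centring `(velShift (-u₀))_# G_N(a, u₀, θ) = G_N(a, 0, θ)`
(`localGibbsLaw_const_map_velShift_neg`), and the statics half of the boost dictionary for orbit functionals of a
flow `Ψ` conjugated to `Φ` along `velShift u` (`lintegral_orbit_conj_velShift`, `lintegral_window_conj_velShift`).
-/

noncomputable section

open Set Function MeasureTheory ProbabilityTheory
open scoped ENNReal
open Literature.Analysis.FluidPDE Literature.MathematicalPhysics.KineticTheory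

namespace Summit.AtomisticToContinuum.HydrodynamicLimit.Theorems.KineticWindowGronwallBoost

/-! ### Gaussian velocities under `v ↦ v + u` -/

section Gauss

variable {E : Type*} [NormedAddCommGroup E] [InnerProductSpace ℝ E] [FiniteDimensional ℝ E]
  [MeasurableSpace E] [BorelSpace E]

/-- **Translating an isotropic Gaussian**: the image of `N(u₀, θ id)` under `v ↦ v + u` is `N(u₀ + u, θ id)` (any
`θ`; both are affine images of the standard Gaussian and `u₀ + √θ w + u = (u₀ + u) + √θ w`). [folklore] -/
theorem gaussMeasure_map_add_const (u₀ : E) (θ : ℝ) (u : E) :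
    (gaussMeasure u₀ θ).map (fun v => v + u) = gaussMeasure (u₀ + u) θ := by
  rw [gaussMeasure, gaussMeasure, Measure.map_map (measurable_add_const u) (measurable_gaussShift u₀ θ)]
  congr 1
  funext w
  simp only [comp_apply, add_right_comm u₀ _ u]

/-- The same for i.i.d. families: `⊗ᵢ N(u₀, θ)` is mapped by `v ↦ (vᵢ + u)ᵢ` to `⊗ᵢ N(u₀ + u, θ)`. [folklore] -/
theorem pi_gaussMeasure_map_add_const (n : ℕ) (u₀ : E) (θ : ℝ) (u : E) :
    (Measure.pi fun _ : Fin n => gaussMeasure u₀ θ).map (fun v i => v i + u) =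
      Measure.pi fun _ : Fin n => gaussMeasure (u₀ + u) θ :=
  (measurePreserving_pi (fun _ : Fin n => gaussMeasure u₀ θ) (fun _ : Fin n => gaussMeasure (u₀ + u) θ)
    fun _ => ⟨measurable_add_const u, gaussMeasure_map_add_const u₀ θ u⟩).map_eq

end Gauss

/-! ### The velocity translation `velShift u` -/

section VelShift

variable {N : ℕ}

/-- The **velocity translation** (Galilean boost at time `0`) of the torus phase space `(𝕋³ × ℝ³)^N`:
`velShift u z = (x_i, v_i + u)_i` — positions untouched, every velocity translated by `u`. This is the time-`0` map
`boostAt u 0` of the sibling trajectory layer (equal to it by `funext`). [folklore] -/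
def velShift (u : V3) (z : Config N (Fin 3) T3) : Config N (Fin 3) T3 := fun i => ((z i).1, (z i).2 + u)

/-- Unfolding lemma: `velShift u z i = (x_i, v_i + u)`. [folklore] -/
@[simp]
theorem velShift_apply (u : V3) (z : Config N (Fin 3) T3) (i : Fin N) : velShift u z i = ((z i).1, (z i).2 + u) :=
  rfl

/-- Positions are untouched by `velShift`. [folklore] -/
theorem velShift_apply_fst (u : V3) (z : Config N (Fin 3) T3) (i : Fin N) : (velShift u z i).1 = (z i).1 := rfl

/-- Velocities are translated by `u` under `velShift u`. [folklore] -/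
theorem velShift_apply_snd (u : V3) (z : Config N (Fin 3) T3) (i : Fin N) : (velShift u z i).2 = (z i).2 + u := rfl

/-- `velShift u` is literally the map `z ↦ (i ↦ (x_i, v_i + u))` of the registered statement. [folklore] -/
theorem velShift_eq (u : V3) :
    (velShift u : Config N (Fin 3) T3 → Config N (Fin 3) T3) = fun z i => ((z i).1, (z i).2 + u) := rfl

/-- Translating by `0` is the identity. [folklore] -/
@[simp]
theorem velShift_zero (z : Config N (Fin 3) T3) : velShift (0 : V3) z = z := by
  funext i
  rw [velShift_apply, add_zero]

/-- As a map, `velShift 0 = id`. [folklore] -/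
theorem velShift_zero_eq_id : (velShift (0 : V3) : Config N (Fin 3) T3 → Config N (Fin 3) T3) = id :=
  funext velShift_zero

/-- **Group law**: `velShift u ∘ velShift u' = velShift (u + u')`. [folklore] -/
theorem velShift_velShift (u u' : V3) (z : Config N (Fin 3) T3) :
    velShift u (velShift u' z) = velShift (u + u') z := by
  funext i
  simp only [velShift_apply, add_assoc, add_comm u' u]

/-- `velShift (u + u') = velShift u ∘ velShift u'`. [folklore] -/
theorem velShift_add (u u' : V3) (z : Config N (Fin 3) T3) :
    velShift (u + u') z = velShift u (velShift u' z) :=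
  (velShift_velShift u u' z).symm

/-- Velocity translations commute. [folklore] -/
theorem velShift_comm (u u' : V3) (z : Config N (Fin 3) T3) :
    velShift u (velShift u' z) = velShift u' (velShift u z) := by
  rw [velShift_velShift, velShift_velShift, add_comm]

/-- `velShift (-u)` is a left inverse of `velShift u`. [folklore] -/
@[simp]
theorem velShift_neg_velShift (u : V3) (z : Config N (Fin 3) T3) : velShift (-u) (velShift u z) = z := by
  rw [velShift_velShift, neg_add_cancel, velShift_zero]

/-- `velShift (-u)` is a right inverse of `velShift u`. [folklore] -/
@[simp]
theorem velShift_velShift_neg (u : V3) (z : Config N (Fin 3) T3) : velShift u (velShift (-u) z) = z := by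
  rw [velShift_velShift, add_neg_cancel, velShift_zero]

/-- `velShift u` is injective. [folklore] -/
theorem velShift_injective (u : V3) : Injective (velShift u : Config N (Fin 3) T3 → Config N (Fin 3) T3) :=
  fun z z' h => by rw [← velShift_neg_velShift u z, h, velShift_neg_velShift]

/-- `velShift u` is surjective. [folklore] -/
theorem velShift_surjective (u : V3) : Surjective (velShift u : Config N (Fin 3) T3 → Config N (Fin 3) T3) :=
  fun z => ⟨velShift (-u) z, velShift_velShift_neg u z⟩

/-- The image of a set under `velShift u` is its preimage under `velShift (-u)`. [folklore] -/
theorem image_velShift_eq_preimage (u : V3) (s : Set (Config N (Fin 3) T3)) :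
    velShift u '' s = velShift (-u) ⁻¹' s :=
  congrFun (image_eq_preimage_of_inverse (velShift_neg_velShift u) (velShift_velShift_neg u)) s

/-- Relative velocities are boost invariant. [folklore] -/
theorem vel_sub_vel_velShift (u : V3) (z : Config N (Fin 3) T3) (i j : Fin N) :
    (velShift u z i).2 - (velShift u z j).2 = (z i).2 - (z j).2 := by
  simp only [velShift_apply, add_sub_add_right_eq_sub]

/-- The hard-sphere domain (a condition on positions only) is invariant under `velShift u`. [folklore] -/
theorem velShift_mem_hardSphereDomain_iff {ε : ℝ} {u : V3} {z : Config N (Fin 3) T3} :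
    velShift u z ∈ hardSphereDomain (Torus.geometry (Fin 3)) N ε ↔ z ∈ hardSphereDomain (Torus.geometry (Fin 3)) N ε := by
  simp only [mem_hardSphereDomain, velShift_apply]

/-- Preimage form: `velShift u ⁻¹' D_ε = D_ε`. [folklore] -/
theorem preimage_velShift_hardSphereDomain (ε : ℝ) (u : V3) :
    velShift u ⁻¹' hardSphereDomain (Torus.geometry (Fin 3)) N ε = hardSphereDomain (Torus.geometry (Fin 3)) N ε :=
  Set.ext fun _ => velShift_mem_hardSphereDomain_iff

/-- `velShift u` is measurable. [folklore] -/
@[fun_prop]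
theorem measurable_velShift (u : V3) : Measurable (velShift u : Config N (Fin 3) T3 → Config N (Fin 3) T3) :=
  measurable_pi_lambda _ fun i => (measurable_pi_apply i).fst.prodMk ((measurable_pi_apply i).snd.add_const u)

/-- `velShift u` is continuous. [folklore] -/
@[fun_prop]
theorem continuous_velShift (u : V3) : Continuous (velShift u : Config N (Fin 3) T3 → Config N (Fin 3) T3) :=
  continuous_pi fun i => ((continuous_apply i).fst).prodMk ((continuous_apply i).snd.add continuous_const)

/-- `velShift u` as a measurable automorphism of the torus phase space, with inverse `velShift (-u)`. [folklore] -/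
def velShiftEquiv (u : V3) : Config N (Fin 3) T3 ≃ᵐ Config N (Fin 3) T3 where
  toFun := velShift u
  invFun := velShift (-u)
  left_inv := velShift_neg_velShift u
  right_inv := velShift_velShift_neg u
  measurable_toFun := measurable_velShift u
  measurable_invFun := measurable_velShift (-u)

/-- Unfolding lemma for `velShiftEquiv`. [folklore] -/
@[simp]
theorem coe_velShiftEquiv (u : V3) : ⇑(velShiftEquiv (N := N) u) = velShift u := rfl

/-- The inverse of `velShiftEquiv u` is the translation by `-u`. [folklore] -/
@[simp]
theorem coe_velShiftEquiv_symm (u : V3) : ⇑(velShiftEquiv (N := N) u).symm = velShift (-u) := rfl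

/-- `velShift u` is a measurable embedding (so push-forwards along it need no measurability of integrands). [folklore] -/
theorem measurableEmbedding_velShift (u : V3) :
    MeasurableEmbedding (velShift u : Config N (Fin 3) T3 → Config N (Fin 3) T3) :=
  (velShiftEquiv u).measurableEmbedding

/-- `velShift u` preserves Lebesgue measure on the torus phase space (factor by factor: identity on `𝕋³` times the
translation `v ↦ v + u` of `ℝ³`). [folklore] -/
theorem measurePreserving_velShift_volume (u : V3) :
    MeasurePreserving (velShift u : Config N (Fin 3) T3 → Config N (Fin 3) T3) volume volume := by
  have h1 : MeasurePreserving (fun p : T3 × V3 => (p.1, p.2 + u)) volume volume :=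
    (MeasurePreserving.id (volume : Measure T3)).prod (measurePreserving_add_right (volume : Measure V3) u)
  haveI : SigmaFinite (volume : Measure (T3 × V3)) := inferInstance
  exact measurePreserving_pi (fun _ : Fin N => (volume : Measure (T3 × V3)))
    (fun _ : Fin N => (volume : Measure (T3 × V3))) (fun _ => h1)

/-- `velShift u` acts on a zipped configuration by translating the velocity block. [folklore] -/
theorem velShift_zipConfig (u : V3) (p : (Fin N → T3) × (Fin N → V3)) :
    velShift u (zipConfig p) = zipConfig (p.1, fun i => p.2 i + u) := by
  funext i
  rfl

/-- As maps: `velShift u ∘ zipConfig = zipConfig ∘ Prod.map id (v ↦ (vᵢ + u)ᵢ)`. [folklore] -/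
theorem velShift_comp_zipConfig (u : V3) :
    (velShift u ∘ zipConfig : (Fin N → T3) × (Fin N → V3) → Config N (Fin 3) T3) =
      zipConfig ∘ Prod.map id (fun v i => v i + u) := by
  funext p
  exact velShift_zipConfig u p

end VelShift

/-! ### The homogeneous local Gibbs law under `velShift u` -/

section Gibbs

/-- **The flow-free homogeneous local Gibbs measure under `velShift u`** (`a ≥ 0`, `θ > 0`):
`(velShift u)_# G_N(a, u₀, θ) = G_N(a, u₀ + u, θ)` — positions and their Gibbs factor are untouched, the i.i.d.
Maxwellian velocities `N(u₀, θ)` become `N(u₀ + u, θ)` (rung-0 product structure `localGibbsMeasure_rung0_eq_map`).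
[folklore] -/
theorem localGibbsMeasure_const_map_velShift (σ : ℝ) {a θ : ℝ} (ha : 0 ≤ a) (hθ : 0 < θ) (u₀ u : V3) (N : ℕ) :
    (localGibbsMeasure σ (fun _ => a) (fun _ => u₀) (fun _ => θ) N).map (velShift u) =
      localGibbsMeasure σ (fun _ => a) (fun _ => u₀ + u) (fun _ => θ) N := by
  haveI : SigmaFinite (posGibbsMeasure (fun _ : T3 => a) (hsDiameter σ N) (N + 1)) := by
    unfold posGibbsMeasure; infer_instance
  have hvel : MeasurePreserving (fun (v : Fin (N + 1) → V3) i => v i + u)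
      (Measure.pi fun _ : Fin (N + 1) => gaussMeasure u₀ θ)
      (Measure.pi fun _ : Fin (N + 1) => gaussMeasure (u₀ + u) θ) :=
    measurePreserving_pi _ _ fun _ => ⟨measurable_add_const u, gaussMeasure_map_add_const u₀ θ u⟩
  have hprod := (MeasurePreserving.id (posGibbsMeasure (fun _ : T3 => a) (hsDiameter σ N) (N + 1))).prod hvel
  rw [localGibbsMeasure_rung0_eq_map σ ha hθ u₀ N, localGibbsMeasure_rung0_eq_map σ ha hθ (u₀ + u) N,
    Measure.map_map (measurable_velShift u) measurable_zipConfig, velShift_comp_zipConfig,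
    ← Measure.map_map measurable_zipConfig (measurable_id.prodMap hvel.measurable), ← hprod.map_eq]

/-- **THE HOMOGENEOUS LOCAL GIBBS LAW UNDER `velShift u`** (every activity `a`, `θ > 0`, all `u₀, u`, any type-fixing
flows `Φ, Ψ`): `(velShift u)_# G_N(a, u₀, θ) = G_N(a, u₀ + u, θ)`. For `a ≥ 0` this is the previous lemma; for `a < 0`
the activity cancels from the canonical density (reduction to `a = 1`). [folklore] -/
theorem localGibbsLaw_const_map_velShift (σ a : ℝ) {θ : ℝ} (hθ : 0 < θ) (u₀ u : V3) (N : ℕ)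
    (Φ Ψ : HardSphereFlow (Torus.geometry (Fin 3)) (hsDiameter σ N) (N + 1)) :
    (localGibbsLaw σ (fun _ => a) (fun _ => u₀) (fun _ => θ) N Φ).map (velShift u) =
      localGibbsLaw σ (fun _ => a) (fun _ => u₀ + u) (fun _ => θ) N Ψ := by
  rcases le_or_gt 0 a with ha | ha
  · rw [localGibbsLaw_eq, localGibbsLaw_eq, localGibbsMeasure_const_map_velShift σ ha hθ u₀ u N]
  · rw [KineticWindowGronwallNegative.localGibbsLaw_const_activity ha.ne,
      KineticWindowGronwallNegative.localGibbsLaw_const_activity ha.ne, localGibbsLaw_eq, localGibbsLaw_eq,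
      localGibbsMeasure_const_map_velShift σ zero_le_one hθ u₀ u N]

/-- The registered form, with the translation map written out: `(z ↦ (x_i, v_i + u)_i)_# G_N(a, u₀, θ) = G_N(a, u₀ + u, θ)`.
[folklore] -/
theorem localGibbsLaw_const_map_fun (σ a : ℝ) {θ : ℝ} (hθ : 0 < θ) (u₀ u : V3) (N : ℕ)
    (Φ Ψ : HardSphereFlow (Torus.geometry (Fin 3)) (hsDiameter σ N) (N + 1)) :
    (localGibbsLaw σ (fun _ => a) (fun _ => u₀) (fun _ => θ) N Φ).map
        (fun (z : Config (N + 1) (Fin 3) T3) (i : Fin (N + 1)) => ((z i).1, (z i).2 + u)) =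
      localGibbsLaw σ (fun _ => a) (fun _ => u₀ + u) (fun _ => θ) N Ψ :=
  localGibbsLaw_const_map_velShift σ a hθ u₀ u N Φ Ψ

/-- **From the centred law**: `(velShift u)_# G_N(a, 0, θ) = G_N(a, u, θ)` — every homogeneous local Gibbs law is the
boost of the centred one. [folklore] -/
theorem localGibbsLaw_const_map_velShift_zero (σ a : ℝ) {θ : ℝ} (hθ : 0 < θ) (u : V3) (N : ℕ)
    (Φ Ψ : HardSphereFlow (Torus.geometry (Fin 3)) (hsDiameter σ N) (N + 1)) :
    (localGibbsLaw σ (fun _ => a) (fun _ => (0 : V3)) (fun _ => θ) N Φ).map (velShift u) =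
      localGibbsLaw σ (fun _ => a) (fun _ => u) (fun _ => θ) N Ψ := by
  rw [localGibbsLaw_const_map_velShift σ a hθ 0 u N Φ Ψ, zero_add]

/-- **To the centred law**: `(velShift (-u₀))_# G_N(a, u₀, θ) = G_N(a, 0, θ)` — removing the drift. [folklore] -/
theorem localGibbsLaw_const_map_velShift_neg (σ a : ℝ) {θ : ℝ} (hθ : 0 < θ) (u₀ : V3) (N : ℕ)
    (Φ Ψ : HardSphereFlow (Torus.geometry (Fin 3)) (hsDiameter σ N) (N + 1)) :
    (localGibbsLaw σ (fun _ => a) (fun _ => u₀) (fun _ => θ) N Φ).map (velShift (-u₀)) =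
      localGibbsLaw σ (fun _ => a) (fun _ => (0 : V3)) (fun _ => θ) N Ψ := by
  rw [localGibbsLaw_const_map_velShift σ a hθ u₀ (-u₀) N Φ Ψ, add_neg_cancel]

/-- **Expectations in the boosted frame are boosted-observable expectations**: for every `F : Config → ℝ≥0∞`
(no measurability: `velShift u` is a measurable embedding),
`∫⁻ F dG_N(a, u₀ + u, θ) = ∫⁻ F (velShift u z) dG_N(a, u₀, θ)(z)`. [folklore] -/
theorem lintegral_localGibbsLaw_velShift (σ a : ℝ) {θ : ℝ} (hθ : 0 < θ) (u₀ u : V3) (N : ℕ)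
    (Φ Ψ : HardSphereFlow (Torus.geometry (Fin 3)) (hsDiameter σ N) (N + 1)) (F : Config (N + 1) (Fin 3) T3 → ℝ≥0∞) :
    ∫⁻ z, F z ∂(localGibbsLaw σ (fun _ => a) (fun _ => u₀ + u) (fun _ => θ) N Ψ) =
      ∫⁻ z, F (velShift u z) ∂(localGibbsLaw σ (fun _ => a) (fun _ => u₀) (fun _ => θ) N Φ) := by
  rw [← localGibbsLaw_const_map_velShift σ a hθ u₀ u N Φ Ψ, (measurableEmbedding_velShift u).lintegral_map]

/-- The centred form: `∫⁻ F dG_N(a, u, θ) = ∫⁻ F (velShift u z) dG_N(a, 0, θ)(z)`. [folklore] -/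
theorem lintegral_localGibbsLaw_velShift_zero (σ a : ℝ) {θ : ℝ} (hθ : 0 < θ) (u : V3) (N : ℕ)
    (Φ Ψ : HardSphereFlow (Torus.geometry (Fin 3)) (hsDiameter σ N) (N + 1)) (F : Config (N + 1) (Fin 3) T3 → ℝ≥0∞) :
    ∫⁻ z, F z ∂(localGibbsLaw σ (fun _ => a) (fun _ => u) (fun _ => θ) N Ψ) =
      ∫⁻ z, F (velShift u z) ∂(localGibbsLaw σ (fun _ => a) (fun _ => (0 : V3)) (fun _ => θ) N Φ) := by
  rw [← localGibbsLaw_const_map_velShift_zero σ a hθ u N Φ Ψ, (measurableEmbedding_velShift u).lintegral_map]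

/-- The Bochner form: `∫ G dG_N(a, u₀ + u, θ) = ∫ G (velShift u z) dG_N(a, u₀, θ)(z)` for every `G` into a real
normed space (no measurability). [folklore] -/
theorem integral_localGibbsLaw_velShift {E : Type*} [NormedAddCommGroup E] [NormedSpace ℝ E] (σ a : ℝ) {θ : ℝ}
    (hθ : 0 < θ) (u₀ u : V3) (N : ℕ) (Φ Ψ : HardSphereFlow (Torus.geometry (Fin 3)) (hsDiameter σ N) (N + 1))
    (G : Config (N + 1) (Fin 3) T3 → E) :
    ∫ z, G z ∂(localGibbsLaw σ (fun _ => a) (fun _ => u₀ + u) (fun _ => θ) N Ψ) =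
      ∫ z, G (velShift u z) ∂(localGibbsLaw σ (fun _ => a) (fun _ => u₀) (fun _ => θ) N Φ) := by
  rw [← localGibbsLaw_const_map_velShift σ a hθ u₀ u N Φ Ψ, (measurableEmbedding_velShift u).integral_map]

/-- Masses of measurable sets in the boosted frame: `G_N(a, u₀ + u, θ)(S) = G_N(a, u₀, θ)(velShift u ⁻¹' S)`.
[folklore] -/
theorem localGibbsLaw_velShift_apply (σ a : ℝ) {θ : ℝ} (hθ : 0 < θ) (u₀ u : V3) (N : ℕ)
    (Φ Ψ : HardSphereFlow (Torus.geometry (Fin 3)) (hsDiameter σ N) (N + 1))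
    {S : Set (Config (N + 1) (Fin 3) T3)} (hS : MeasurableSet S) :
    localGibbsLaw σ (fun _ => a) (fun _ => u₀ + u) (fun _ => θ) N Ψ S =
      localGibbsLaw σ (fun _ => a) (fun _ => u₀) (fun _ => θ) N Φ (velShift u ⁻¹' S) := by
  rw [← localGibbsLaw_const_map_velShift σ a hθ u₀ u N Φ Ψ, Measure.map_apply (measurable_velShift u) hS]

/-- The boosted law is a probability measure iff the original one is (total masses agree). [folklore] -/
theorem localGibbsLaw_velShift_univ (σ a : ℝ) {θ : ℝ} (hθ : 0 < θ) (u₀ u : V3) (N : ℕ)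
    (Φ Ψ : HardSphereFlow (Torus.geometry (Fin 3)) (hsDiameter σ N) (N + 1)) :
    localGibbsLaw σ (fun _ => a) (fun _ => u₀ + u) (fun _ => θ) N Ψ univ =
      localGibbsLaw σ (fun _ => a) (fun _ => u₀) (fun _ => θ) N Φ univ := by
  rw [localGibbsLaw_velShift_apply σ a hθ u₀ u N Φ Ψ MeasurableSet.univ, preimage_univ]

/-- **THE STATICS HALF OF THE BOOST DICTIONARY** (orbit functionals). Let the flow `Ψ` be conjugated to `Φ` along
`velShift u` by a family of maps `B t` — `Ψ_t (velShift u z) = B t (Φ_t z)` for all `t, z` (layer 2's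
`boost_flow_boostAt` with `B t = boostAt u t`, `velShift u = boostAt u 0`). Then for every functional `H` of the orbit,
`∫⁻ H (t ↦ Ψ_t z) dG_N(a, u₀ + u, θ)(z) = ∫⁻ H (t ↦ B t (Φ_t z)) dG_N(a, u₀, θ)(z)` (no measurability). [folklore] -/
theorem lintegral_orbit_conj_velShift (σ a : ℝ) {θ : ℝ} (hθ : 0 < θ) (u₀ u : V3) (N : ℕ)
    (Φ Ψ : HardSphereFlow (Torus.geometry (Fin 3)) (hsDiameter σ N) (N + 1))
    (B : ℝ → Config (N + 1) (Fin 3) T3 → Config (N + 1) (Fin 3) T3)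
    (hΨ : ∀ t z, Ψ.flow t (velShift u z) = B t (Φ.flow t z))
    (H : (ℝ → Config (N + 1) (Fin 3) T3) → ℝ≥0∞) :
    ∫⁻ z, H (fun t => Ψ.flow t z) ∂(localGibbsLaw σ (fun _ => a) (fun _ => u₀ + u) (fun _ => θ) N Ψ) =
      ∫⁻ z, H (fun t => B t (Φ.flow t z)) ∂(localGibbsLaw σ (fun _ => a) (fun _ => u₀) (fun _ => θ) N Φ) := by
  rw [lintegral_localGibbsLaw_velShift σ a hθ u₀ u N Φ Ψ]
  simp only [hΨ]

/-- **Window functionals** (the shape of the kinetic hypothesis): under the same conjugation, for every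
`Hm : ℝ → ℝ≥0∞` (e.g. `x ↦ ofReal (exp (β x))`), observable `F` and window `[a', b']`,
`∫⁻ Hm (∫_{a'}^{b'} F (Ψ_s z) ds) dG_N(a, u₀ + u, θ) = ∫⁻ Hm (∫_{a'}^{b'} F (B s (Φ_s z)) ds) dG_N(a, u₀, θ)` — the
window functional of the boosted flow under the boosted law is the window functional of `Φ` for the MOVING
observable `(s, z) ↦ F (B s z)` under the original law. [folklore] -/
theorem lintegral_window_conj_velShift (σ a : ℝ) {θ : ℝ} (hθ : 0 < θ) (u₀ u : V3) (N : ℕ)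
    (Φ Ψ : HardSphereFlow (Torus.geometry (Fin 3)) (hsDiameter σ N) (N + 1))
    (B : ℝ → Config (N + 1) (Fin 3) T3 → Config (N + 1) (Fin 3) T3)
    (hΨ : ∀ t z, Ψ.flow t (velShift u z) = B t (Φ.flow t z))
    {E : Type*} [NormedAddCommGroup E] [NormedSpace ℝ E] (Hm : E → ℝ≥0∞) (F : Config (N + 1) (Fin 3) T3 → E)
    (a' b' : ℝ) :
    ∫⁻ z, Hm (∫ s in a'..b', F (Ψ.flow s z)) ∂(localGibbsLaw σ (fun _ => a) (fun _ => u₀ + u) (fun _ => θ) N Ψ) =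
      ∫⁻ z, Hm (∫ s in a'..b', F (B s (Φ.flow s z)))
        ∂(localGibbsLaw σ (fun _ => a) (fun _ => u₀) (fun _ => θ) N Φ) :=
  lintegral_orbit_conj_velShift σ a hθ u₀ u N Φ Ψ B hΨ fun γ => Hm (∫ s in a'..b', F (γ s))

end Gibbs

/-! ### The registered statement -/

/-- THE HOMOGENEOUS LOCAL GIBBS LAW UNDER A VELOCITY TRANSLATION (Galilean boost at time 0). For every reduced
diameter `σ`, activity `a`, temperature `θ > 0`, bulk velocity `u₀`, boost velocity `u`, particle number `N + 1` and
hard-sphere flows `Φ, Ψ` on `𝕋³` of diameter `hsDiameter σ N` (the flows only fix the phase space; `Ψ` is meant to be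
the boosted flow of `Φ`), the image of the homogeneous local Gibbs law `G_N(a, u₀, θ)` under the velocity translation
`z ↦ (x_i, v_i + u)_i` is `G_N(a, u₀ + u, θ)`: the Maxwellian is shifted, positions and the hard-core factor are
untouched, the activity cancels. Folklore (Galilean invariance of the local equilibrium states). -/
def LocalGibbsLawBoost : Prop :=
  ∀ (σ a θ : ℝ) (u₀ u : V3) (N : ℕ) (Φ Ψ : HardSphereFlow (Torus.geometry (Fin 3)) (hsDiameter σ N) (N + 1)), 0 < θ →
    (localGibbsLaw σ (fun _ => a) (fun _ => u₀) (fun _ => θ) N Φ).map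
        (fun (z : Config (N + 1) (Fin 3) T3) (i : Fin (N + 1)) => ((z i).1, (z i).2 + u)) =
      localGibbsLaw σ (fun _ => a) (fun _ => u₀ + u) (fun _ => θ) N Ψ

/-- **Proved**: `stub_boostGibbs` (the statics half of the Galilean boost, `localGibbsLaw_const_map_velShift`). [folklore] -/
theorem stub_boostGibbs : LocalGibbsLawBoost :=
  fun σ a _ u₀ u N Φ Ψ hθ => localGibbsLaw_const_map_velShift σ a hθ u₀ u N Φ Ψ

/-- The registered statement restated through `velShift`. [folklore] -/
theorem localGibbsLawBoost_iff_velShift :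
    LocalGibbsLawBoost ↔
      ∀ (σ a θ : ℝ) (u₀ u : V3) (N : ℕ) (Φ Ψ : HardSphereFlow (Torus.geometry (Fin 3)) (hsDiameter σ N) (N + 1)),
        0 < θ → (localGibbsLaw σ (fun _ => a) (fun _ => u₀) (fun _ => θ) N Φ).map (velShift u) =
          localGibbsLaw σ (fun _ => a) (fun _ => u₀ + u) (fun _ => θ) N Ψ :=
  Iff.rfl

end Summit.AtomisticToContinuum.HydrodynamicLimit.Theorems.KineticWindowGronwallBoost

end
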